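import Summits.QuantumFields.BalabanUV.Beta.GAN24.OrderZeroSlotLaw

/-!
# `BalabanUV.Beta.GAN24.DressedOrderZeroSlotLaw` — binder row G-an2-4 ∕ (CONV-C), route R7 «TWO CURRENCIES», S3 (ρ2) × (ρ5): the
# ORDER-ZERO SLOT DRESSED BY LOCAL VERTICES, `∇ᴴ·h̄₁·𝒢·h₂·∇` — the face-planted King law with multiplications by background fields
# `h₁, h₂` inside (backgrounds as DATA with NE2's letters: size `α`, two-level consistency `δ`, lattice-Lipschitz `β`), the sandwich
# identity for ANY middle operator, and the boundedness of the dressed slot — (P-R7a)'s chain V3 `⟨h∇u, 𝒢 h∇u′⟩` made transportable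

NOT IN PRINT; OUR PROOF ATTEMPT (prover part P3 of row G-an2-4, fibre∕strip («Woodbury») lineage, gen 26; CRUX TEAM (2), ruling «YM
REDIRECT TOWARDS THE SUMMIT», 2026-08-21).  HONEST DEPENDENCY (cell records, verbatim): «continuum YM on T⁴ ⇐ BetaPertH ∧ nine spine
estimates (0/9 proved); BetaPertH ⇐ (D1) ∧ (D4) ∧ CAP+tail; G-an2-4 gates asym, D1 and NE2/3/4.»  HONEST FRAMING (cell contract, verbatim):
«discharging `BetaPertH` makes Bałaban's UV stability UNCONDITIONAL — a real constructive-QFT result; it is NOT the continuum limit and NOT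
the Clay problem.»  ABSOLUTE RULE: nothing printed is a hypothesis; no `def … : Prop`, no sorry; [folklore] algebra over TREE objects BY NAME.

## The item (`HOME/beta/ROUTES-GAN24.md` v8.1 §2 R7 S3 (ρ2) «every order-zero operator in a chain must have an H¹-bounded NEIGHBOUR», S3 (ρ5)
## «vertex transcription … multiplication vertices: commutator [ι, mult_h] = O(η_k sup|∇h|) on H¹», S4 «vertex slots by (ρ5)»; (P-R7a) V3)

`OrderZeroSlotLaw` (gen 26, p265057) treats the BARE slot `∇ᴴ𝒢∇`.  In the u-sector's chains a local multiplication vertex `𝒱[h]` sits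
next to the operator (T1's `D*ad_h`, (P-R7a)'s V3 = `⟨h∇u_y, G_k h∇u_{y′}⟩`): the slot between the value legs is the DRESSED order-zero
operator `R[h₁,h₂] := ∇_μᴴ·diag(h₁)ᴴ·𝒢·diag(h₂)·∇_{μ′}` (`(diag(h₁)∇_μX)ᴴ𝒢(diag(h₂)∇_{μ′}Y) = XᴴR[h₁,h₂]Y`).  THIS FILE: the backgrounds
are DATA carrying NE2's letters (`PerturbationAlgebra.BoundedBackground` ∕ `FirstOrderBackgroundModel` currency — size, consistency at the
block parent, lattice Lipschitz), and
 * §1 PLANTING vs DRESSING: `K_μ·diag(W) = diag(W ∘ parT)·K_μ` (exact; `BlockPairingGeometry.JK_mul_diagonal` + diagonals commute with the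
   far-face indicator), hence `diag(W′)·K_μ − K_μ·diag(W) = (diag W′ − diag(W ∘ parT))·K_μ`, norm `≤ δ·R`;
 * §2 **THE DRESSED FACE-PLANTED KING LAW** `opNorm_faceK_dressed_sub_le`: for `‖W₁‖, ‖W₂′‖ ≤ α` and consistencies `≤ δ`,
   `‖K_μᴴ·(diag W₁′)ᴴ𝒢′(diag W₂′)·K_{μ′} − (diag W₁)ᴴ𝒢(diag W₂)‖ ≤ α²·CK∕N + 2·α·R²·Cst·δ` — from
   `(D₁′K)ᴴ𝒢′(D₂′K′) − D₁ᴴ𝒢D₂ = D₁ᴴ(Kᴴ𝒢′K′ − 𝒢)D₂ + D₁ᴴKᴴ𝒢′E₂ + E₁ᴴ𝒢′(D₂′K′)`, `E_i := (D_i′ − D̄_i)K` (the bare law + two consistency defects);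
 * §3 **THE SANDWICH IDENTITY FOR ANY MIDDLE OPERATOR** `sandwich_general : J_Rᴴ(∇′_μᴴ·T′·∇′_{μ′})J_R = ∇_μᴴ(K_μᴴ·T′·K_{μ′})∇_{μ′}` — so the
   dressed (ρ2) law factors through the coarse differences exactly as the bare one: `sandwich_dressed_sub_eq`;
 * §4 **THE DRESSED SLOT IS BOUNDED** `opNorm_dressedSlot_le`: `‖∇_μᴴ(diag W₁)ᴴ𝒢(diag W₂)∇_{μ′}‖ ≤ (α + β)²·Cst` for `‖W_i‖ ≤ α` and lattice
   Lipschitz `n·|W_i(x+e) − W_i(x)| ≤ β` — ONE Leibniz commutation per side (`BlockPairingGeometry.fdiff_mul_diagonal`) onto (1.89)'s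
   `‖∇ᴴ𝒢∇‖, ‖∇ᴴ𝒢‖, ‖𝒢∇‖, ‖𝒢‖ ≤ Cst` (`FirstOrderAdjointModel.opNorm_fdiffH_diag_calG_le` is the one-sided template): the vertex costs
   `sup|h| + sup|∇_ηh|`, R7 S2 (B-leg)'s printed letters, and NO rate of `h` in sup norm enters the boundedness.
What this buys R7 (with `SoftColumnOrderZeroChain.legChain_sub_eq`): the V3-type chain `Xᴴ·R[h₁,h₂]·X` of value legs is entrywise Cauchy
at rate `max(L^{−k}, δ_k)` modulo the background letters `(α, β, δ_k)` — the companion `DressedOrderZeroChain` instantiates it.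

HONEST SCOPE.  Backgrounds are DATA (no claim that a given Bałaban leg satisfies the letters: for `h` = the physical soft column, `α` is leaf-03's
`SoftColumnSupLetter.sqrt_mul_norm_Mtil_le` (tree), the Lipschitz and consistency letters are NOT in the tree on this carrier — INTERFACE
REQUEST lines of this gen); soft covariance, `U = 1`; supplier work on the route of record; zero on the D1 grid; NOT (CONV-C) (a list), NOT (ρ3),
NEVER «G-an2-4 closed», NOT NE2, NOT D1, NOT BetaPertH, NOT continuum, NOT Clay.  Locators (text only): [Balaban1984PropagatorsI] (1.31) p. 23,
Prop. 1.1 (1.89) p. 33; [King1986] (2.10) p. 653, Prop. 3.8 p. 664–665.  Provenance: prover-b2b-balaban-gan24-p3-g26-0 (unit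
`b2b-balaban-gan24-p3`, gen 26), 2026-08-21.
-/

noncomputable section

open scoped BigOperators ComplexConjugate Matrix Matrix.Norms.L2Operator

namespace Summit.QuantumFields.BalabanUV.Beta.GAN24.DressedOrderZeroSlotLaw

open Literature.MathematicalPhysics.QuantumFieldTheory.Balaban1983to89.B5Prop11Plancherel
open Literature.MathematicalPhysics.QuantumFieldTheory.Balaban1983to89.B5G183RateUnitTower (lev lev_neZero)
open Summit.QuantumFields.BalabanUV.T4Continuum
open Summit.QuantumFields.BalabanUV.T4Continuum.BalabanAveragedTowerUnit (idx calGlev one_le_lev' cast_lev')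
open Summit.QuantumFields.BalabanUV.T4Continuum.BalabanMinimizerLaw (Jpc)
open Summit.QuantumFields.BalabanUV.T4Continuum.KingPairingPlantedLaw (JK opNorm_JK_le)
open Summit.QuantumFields.BalabanUV.T4Continuum.BlockPairingGeometry (tau parT faceF JK_mul_diagonal fdiff_mul_diagonal opNorm_diagonal_le
  opNorm_shiftM_le)
open Summit.QuantumFields.BalabanUV.T4Continuum.BlockPairingFaces (opNorm_calG_mul_fdiff_le)
open Summit.QuantumFields.BalabanUV.T4Continuum.FirstOrderAdjointModel (conjTranspose_fdiff_eq opNorm_fdiffH_diag_calG_le)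
open Summit.QuantumFields.BalabanUV.T4Continuum.KingLaplacianConsistency (gradC gradF)
open Summit.QuantumFields.BalabanUV.Beta.GAN24.OrderZeroSlotLaw

variable {d : ℕ}

/-! ## §1 Planting versus dressing -/

section TwoLevel

variable (N R : ℕ) [NeZero N] [NeZero R] (M : Fin d → ℕ) [hM : ∀ μ, NeZero (M μ)]

/-- **`K_μ·diag(W) = diag(W ∘ parT)·K_μ`** (exact): dressing a coarse field by `W` and planting it on the far faces is planting it and dressing
by `W ∘ par`. [folklore] -/
theorem faceK_mul_diagonal (μ : Fin d) (W : Tor (fine N M) × Fin d → ℂ) :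
    faceK N R M μ * Matrix.diagonal W = Matrix.diagonal (W ∘ parT N R M) * faceK N R M μ := by
  have h5 : faceF N R M μ * Matrix.diagonal (W ∘ parT N R M) = Matrix.diagonal (W ∘ parT N R M) * faceF N R M μ := by
    rw [faceF, Matrix.diagonal_mul_diagonal, Matrix.diagonal_mul_diagonal]
    congr 1; funext i; ring
  rw [faceK, Matrix.smul_mul, Matrix.mul_smul, Matrix.mul_assoc, JK_mul_diagonal, ← Matrix.mul_assoc, h5, Matrix.mul_assoc]

/-- the dressing defect of the planting: `diag(W′)·K_μ − K_μ·diag(W) = (diag W′ − diag(W ∘ parT))·K_μ`. [folklore] -/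
theorem diagonal_mul_faceK_sub (μ : Fin d) (W' : Tor (fine (R * N) M) × Fin d → ℂ) (W : Tor (fine N M) × Fin d → ℂ) :
    Matrix.diagonal W' * faceK N R M μ - faceK N R M μ * Matrix.diagonal W
      = (Matrix.diagonal W' - Matrix.diagonal (W ∘ parT N R M)) * faceK N R M μ := by
  rw [faceK_mul_diagonal, Matrix.sub_mul]

/-- its size: `‖diag(W′)·K_μ − K_μ·diag(W)‖ ≤ δ·R` when `|W′(x′) − W(parT x′)| ≤ δ`. [folklore] -/
theorem opNorm_diagonal_mul_faceK_sub_le (μ : Fin d) {W' : Tor (fine (R * N) M) × Fin d → ℂ} {W : Tor (fine N M) × Fin d → ℂ} {δ : ℝ}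
    (hδ : 0 ≤ δ) (hcons : ∀ i, ‖W' i - W (parT N R M i)‖ ≤ δ) :
    ‖Matrix.diagonal W' * faceK N R M μ - faceK N R M μ * Matrix.diagonal W‖ ≤ δ * R := by
  rw [diagonal_mul_faceK_sub, Matrix.diagonal_sub]
  exact (Matrix.l2_opNorm_mul _ _).trans (mul_le_mul (opNorm_diagonal_le _ hδ fun i => hcons i) (opNorm_faceK_le N R M μ) (norm_nonneg _) hδ)

/-! ## §2 The dressed face-planted King law -/

variable (a : ℝ) (ha : 0 < a)

/-- **THE DRESSED FACE-PLANTED KING LAW** (finite torus, `N, R ≥ 1`, `a > 0`, `d ≥ 1`; backgrounds as DATA): for coarse fields `W₁, W₂` and fine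
fields `W₁′, W₂′` with `‖W₁‖, ‖W₂‖, ‖W₂′‖ ≤ α` and the two-level consistencies `|W_i′(x′) − W_i(parT x′)| ≤ δ`,
`‖K_μᴴ·(diag W₁′)ᴴ·𝒢^{(η∕R)}·(diag W₂′)·K_{μ′} − (diag W₁)ᴴ·𝒢^{(η)}·(diag W₂)‖ ≤ α²·CK∕N + 2·α·R²·Cst·δ`.  From
`(D₁′K)ᴴ𝒢′(D₂′K′) − D₁ᴴ𝒢D₂ = D₁ᴴ(Kᴴ𝒢′K′ − 𝒢)D₂ + D₁ᴴKᴴ𝒢′E₂ + E₁ᴴ𝒢′(D₂′K′)`, `E_i = D_i′K − KD_i`.  Statement and constant OURS.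
[cite: King1986, (2.10) p.653, Lemma 4.5 (4.38) p.674; Balaban1984PropagatorsI, Prop. 1.1 (1.89) p.33] [folklore] -/
theorem opNorm_faceK_dressed_sub_le (hd : 1 ≤ d) (hN : 1 ≤ N) (hR : 1 ≤ R) (hRN : 1 ≤ R * N) (μ μ' : Fin d)
    {W₁' W₂' : Tor (fine (R * N) M) × Fin d → ℂ} {W₁ W₂ : Tor (fine N M) × Fin d → ℂ} {α δ : ℝ} (hα : 0 ≤ α) (hδ : 0 ≤ δ)
    (hW₁ : ∀ i, ‖W₁ i‖ ≤ α) (hW₂ : ∀ i, ‖W₂ i‖ ≤ α) (hW₂' : ∀ i, ‖W₂' i‖ ≤ α)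
    (hc₁ : ∀ i, ‖W₁' i - W₁ (parT N R M i)‖ ≤ δ) (hc₂ : ∀ i, ‖W₂' i - W₂ (parT N R M i)‖ ≤ δ) :
    ‖(faceK N R M μ)ᴴ * ((Matrix.diagonal W₁')ᴴ * calG (R * N) hRN M a ha * Matrix.diagonal W₂') * faceK N R M μ'
        - (Matrix.diagonal W₁)ᴴ * calG N hN M a ha * Matrix.diagonal W₂‖
      ≤ α * (CK d R a / N) * α + (α * R * (Cst d a * (δ * R)) + (δ * R) * (Cst d a * (α * R))) := by
  have hCst := Cst_nonneg d a
  have hRpos : (0 : ℝ) ≤ R := Nat.cast_nonneg R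
  -- the defects and the letters, BEFORE abbreviating
  have hE₁ : ‖Matrix.diagonal W₁' * faceK N R M μ - faceK N R M μ * Matrix.diagonal W₁‖ ≤ δ * R :=
    opNorm_diagonal_mul_faceK_sub_le N R M μ hδ hc₁
  have hE₂ : ‖Matrix.diagonal W₂' * faceK N R M μ' - faceK N R M μ' * Matrix.diagonal W₂‖ ≤ δ * R :=
    opNorm_diagonal_mul_faceK_sub_le N R M μ' hδ hc₂
  have hS : ‖(faceK N R M μ)ᴴ * calG (R * N) hRN M a ha * faceK N R M μ' - calG N hN M a ha‖ ≤ CK d R a / N :=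
    opNorm_faceK_calG_faceK_sub_le N R M a ha hd hN hR hRN μ μ'
  have hD₁t : ‖(Matrix.diagonal W₁)ᴴ‖ ≤ α := by rw [Matrix.l2_opNorm_conjTranspose]; exact opNorm_diagonal_le _ hα hW₁
  have hD₂ : ‖Matrix.diagonal W₂‖ ≤ α := opNorm_diagonal_le _ hα hW₂
  have hD₂' : ‖Matrix.diagonal W₂'‖ ≤ α := opNorm_diagonal_le _ hα hW₂'
  have hG' : ‖calG (R * N) hRN M a ha‖ ≤ Cst d a := opNorm_calG_le (R * N) hRN M a ha
  have hKt : ‖(faceK N R M μ)ᴴ‖ ≤ R := by rw [Matrix.l2_opNorm_conjTranspose]; exact opNorm_faceK_le N R M μ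
  have hK' : ‖faceK N R M μ'‖ ≤ R := opNorm_faceK_le N R M μ'
  have hσ : 0 ≤ CK d R a / N := (norm_nonneg _).trans hS
  set K := faceK N R M μ
  set K' := faceK N R M μ'
  set G' := calG (R * N) hRN M a ha
  set G := calG N hN M a ha
  set D₁' := Matrix.diagonal W₁'
  set D₂' := Matrix.diagonal W₂'
  set D₁ := Matrix.diagonal W₁
  set D₂ := Matrix.diagonal W₂
  have hE₁t : ‖(D₁' * K - K * D₁)ᴴ‖ ≤ δ * R := by rw [Matrix.l2_opNorm_conjTranspose]; exact hE₁
  -- the decomposition `(D₁′K)ᴴ𝒢′(D₂′K′) − D₁ᴴ𝒢D₂ = D₁ᴴ(Kᴴ𝒢′K′ − 𝒢)D₂ + D₁ᴴKᴴ𝒢′E₂ + E₁ᴴ𝒢′(D₂′K′)`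
  have e : Kᴴ * (D₁'ᴴ * G' * D₂') * K' - D₁ᴴ * G * D₂
      = D₁ᴴ * (Kᴴ * G' * K' - G) * D₂ + D₁ᴴ * Kᴴ * (G' * (D₂' * K' - K' * D₂)) + (D₁' * K - K * D₁)ᴴ * (G' * (D₂' * K')) := by
    simp only [Matrix.conjTranspose_sub, Matrix.conjTranspose_mul, Matrix.sub_mul, Matrix.mul_sub, Matrix.mul_assoc]
    abel
  rw [e]
  have t1 : ‖D₁ᴴ * (Kᴴ * G' * K' - G) * D₂‖ ≤ α * (CK d R a / N) * α :=
    (Matrix.l2_opNorm_mul _ _).trans (mul_le_mul ((Matrix.l2_opNorm_mul _ _).trans (mul_le_mul hD₁t hS (norm_nonneg _) hα))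
      hD₂ (norm_nonneg _) (mul_nonneg hα hσ))
  have t2 : ‖D₁ᴴ * Kᴴ * (G' * (D₂' * K' - K' * D₂))‖ ≤ α * R * (Cst d a * (δ * R)) :=
    (Matrix.l2_opNorm_mul _ _).trans (mul_le_mul ((Matrix.l2_opNorm_mul _ _).trans (mul_le_mul hD₁t hKt (norm_nonneg _) hα))
      ((Matrix.l2_opNorm_mul _ _).trans (mul_le_mul hG' hE₂ (norm_nonneg _) hCst)) (norm_nonneg _) (mul_nonneg hα hRpos))
  have t3 : ‖(D₁' * K - K * D₁)ᴴ * (G' * (D₂' * K'))‖ ≤ (δ * R) * (Cst d a * (α * R)) :=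
    (Matrix.l2_opNorm_mul _ _).trans (mul_le_mul hE₁t ((Matrix.l2_opNorm_mul _ _).trans (mul_le_mul hG'
      ((Matrix.l2_opNorm_mul _ _).trans (mul_le_mul hD₂' hK' (norm_nonneg _) hα)) (norm_nonneg _) hCst)) (norm_nonneg _)
      (mul_nonneg hδ hRpos))
  calc _ ≤ ‖D₁ᴴ * (Kᴴ * G' * K' - G) * D₂ + D₁ᴴ * Kᴴ * (G' * (D₂' * K' - K' * D₂))‖ + ‖(D₁' * K - K * D₁)ᴴ * (G' * (D₂' * K'))‖ :=
        norm_add_le _ _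
    _ ≤ (α * (CK d R a / N) * α + α * R * (Cst d a * (δ * R))) + (δ * R) * (Cst d a * (α * R)) :=
        add_le_add ((norm_add_le _ _).trans (add_le_add t1 t2)) t3
    _ = _ := by ring

/-- the same bound, tidied: `≤ α²·CK∕N + 2·α·R²·Cst·δ`. [folklore] -/
theorem opNorm_faceK_dressed_sub_le' (hd : 1 ≤ d) (hN : 1 ≤ N) (hR : 1 ≤ R) (hRN : 1 ≤ R * N) (μ μ' : Fin d)
    {W₁' W₂' : Tor (fine (R * N) M) × Fin d → ℂ} {W₁ W₂ : Tor (fine N M) × Fin d → ℂ} {α δ : ℝ} (hα : 0 ≤ α) (hδ : 0 ≤ δ)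
    (hW₁ : ∀ i, ‖W₁ i‖ ≤ α) (hW₂ : ∀ i, ‖W₂ i‖ ≤ α) (hW₂' : ∀ i, ‖W₂' i‖ ≤ α)
    (hc₁ : ∀ i, ‖W₁' i - W₁ (parT N R M i)‖ ≤ δ) (hc₂ : ∀ i, ‖W₂' i - W₂ (parT N R M i)‖ ≤ δ) :
    ‖(faceK N R M μ)ᴴ * ((Matrix.diagonal W₁')ᴴ * calG (R * N) hRN M a ha * Matrix.diagonal W₂') * faceK N R M μ'
        - (Matrix.diagonal W₁)ᴴ * calG N hN M a ha * Matrix.diagonal W₂‖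
      ≤ α * α * CK d R a / N + 2 * α * ((R : ℝ) * R) * Cst d a * δ := by
  refine (opNorm_faceK_dressed_sub_le N R M a ha hd hN hR hRN μ μ' hα hδ hW₁ hW₂ hW₂' hc₁ hc₂).trans (le_of_eq ?_)
  ring

/-! ## §3 The sandwich identity for any middle operator; the dressed (ρ2) law in R7's currency -/

/-- **`J_Rᴴ·(∇′_μᴴ·T′·∇′_{μ′})·J_R = ∇_μᴴ·(K_μᴴ·T′·K_{μ′})·∇_{μ′}`** for ANY fine operator `T′` (exact; only `∇′J = K∇` enters).
[cite: King1986, (2.10) p.653; Balaban1984PropagatorsI, (1.31) p.23] [folklore] -/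
theorem sandwich_general (hN : 1 ≤ N) (μ μ' : Fin d)
    (T' : Matrix (Tor (fine (R * N) M) × Fin d) (Tor (fine (R * N) M) × Fin d) ℂ) :
    (JK N R M)ᴴ * ((gradF N R M μ)ᴴ * T' * gradF N R M μ') * JK N R M
      = (gradC N M μ)ᴴ * ((faceK N R M μ)ᴴ * T' * faceK N R M μ') * gradC N M μ' := by
  have h1 : gradF N R M μ' * JK N R M = faceK N R M μ' * gradC N M μ' := gradF_mul_JK N R M hN μ'
  have h2 : (JK N R M)ᴴ * (gradF N R M μ)ᴴ = (gradC N M μ)ᴴ * (faceK N R M μ)ᴴ := by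
    rw [← Matrix.conjTranspose_mul, ← Matrix.conjTranspose_mul, gradF_mul_JK N R M hN μ]
  calc _ = ((JK N R M)ᴴ * (gradF N R M μ)ᴴ) * T' * (gradF N R M μ' * JK N R M) := by simp only [Matrix.mul_assoc]
    _ = ((gradC N M μ)ᴴ * (faceK N R M μ)ᴴ) * T' * (faceK N R M μ' * gradC N M μ') := by rw [h1, h2]
    _ = _ := by simp only [Matrix.mul_assoc]

/-- **THE DRESSED (ρ2) LAW IN R7's CURRENCY** (exact): `J_Rᴴ(∇′_μᴴ·T′·∇′_{μ′})J_R − ∇_μᴴ·T·∇_{μ′} = ∇_μᴴ·(K_μᴴT′K_{μ′} − T)·∇_{μ′}` for any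
fine∕coarse middle operators `T′, T` — with `T′ = (diag W₁′)ᴴ𝒢′(diag W₂′)`, `T = (diag W₁)ᴴ𝒢(diag W₂)` the middle factor is `O(1∕N + δ)` by §2:
the order-zero slot DRESSED BY LOCAL VERTICES is Cauchy against its H¹ neighbours. [folklore] -/
theorem sandwich_general_sub_eq (hN : 1 ≤ N) (μ μ' : Fin d)
    (T' : Matrix (Tor (fine (R * N) M) × Fin d) (Tor (fine (R * N) M) × Fin d) ℂ) (T : Matrix (Tor (fine N M) × Fin d) (Tor (fine N M) × Fin d) ℂ) :
    (JK N R M)ᴴ * ((gradF N R M μ)ᴴ * T' * gradF N R M μ') * JK N R M - (gradC N M μ)ᴴ * T * gradC N M μ'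
      = (gradC N M μ)ᴴ * ((faceK N R M μ)ᴴ * T' * faceK N R M μ' - T) * gradC N M μ' := by
  rw [sandwich_general N R M hN μ μ' T', Matrix.mul_sub, Matrix.sub_mul]

end TwoLevel

/-! ## §4 The dressed slot is bounded: one Leibniz commutation per side -/

section Level

variable (n : ℕ) [NeZero n] (hn : 1 ≤ n) (M : Fin d → ℕ) [hM : ∀ μ, NeZero (M μ)] (a : ℝ) (ha : 0 < a)

/-- the backward-shifted field `W₋(x) := W(x − e_μ)`, so that `W₋ ∘ τ_μ = W`. [folklore] -/
def shiftBack (μ : Fin d) (W : Tor (fine n M) × Fin d → ℂ) : Tor (fine n M) × Fin d → ℂ :=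
  fun i => W (i.1 - unitVec (fine n M) μ, i.2)

omit [NeZero n] hM in
/-- `W₋ ∘ τ_μ = W`. [folklore] -/
theorem shiftBack_comp_tau (μ : Fin d) (W : Tor (fine n M) × Fin d → ℂ) : shiftBack n M μ W ∘ tau (fine n M) μ = W := by
  funext i
  simp only [Function.comp_apply, shiftBack, tau, add_sub_cancel_right]

/-- **`diag(W)·∇_μ = ∇_μ·diag(W₋) − n·(diag W − diag W₋)`** — the discrete Leibniz rule read from the left
(`BlockPairingGeometry.fdiff_mul_diagonal` at `W₋`). [cite: Balaban1984PropagatorsI, (1.31) p.23] [folklore] -/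
theorem diagonal_mul_fdiff (μ : Fin d) (W : Tor (fine n M) × Fin d → ℂ) :
    Matrix.diagonal W * fdiff (fine n M) ((n : ℕ) : ℂ) μ
      = fdiff (fine n M) ((n : ℕ) : ℂ) μ * Matrix.diagonal (shiftBack n M μ W)
        - ((n : ℕ) : ℂ) • (Matrix.diagonal W - Matrix.diagonal (shiftBack n M μ W)) := by
  have h := fdiff_mul_diagonal (fine n M) ((n : ℕ) : ℂ) μ (shiftBack n M μ W)
  rw [shiftBack_comp_tau] at h
  rw [h, add_sub_cancel_right]

/-- **`‖𝒢·diag(W)·∇_μ‖ ≤ (α + β)·Cst`** for `|W| ≤ α` and lattice-Lipschitz `n·|W(x) − W(x − e_μ)| ≤ β` (Leibniz + (1.89): `‖𝒢∇‖, ‖𝒢‖ ≤ Cst`).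
[cite: Balaban1984PropagatorsI, Prop. 1.1 (1.89) p.33] [folklore] -/
theorem opNorm_calG_diag_fdiff_le (μ : Fin d) {W : Tor (fine n M) × Fin d → ℂ} {α β : ℝ} (hα : 0 ≤ α) (hβ : 0 ≤ β)
    (hW : ∀ i, ‖W i‖ ≤ α) (hLip : ∀ i, ‖W i - shiftBack n M μ W i‖ ≤ β / n) :
    ‖calG n hn M a ha * Matrix.diagonal W * fdiff (fine n M) ((n : ℕ) : ℂ) μ‖ ≤ (α + β) * Cst d a := by
  have hnpos : (0 : ℝ) < n := by exact_mod_cast hn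
  have hC := Cst_nonneg d a
  have hG : ‖calG n hn M a ha‖ ≤ Cst d a := opNorm_calG_le n hn M a ha
  have hG1 : ‖calG n hn M a ha * fdiff (fine n M) ((n : ℕ) : ℂ) μ‖ ≤ Cst d a := opNorm_calG_mul_fdiff_le n M a ha hn μ
  have hWb : ∀ i, ‖shiftBack n M μ W i‖ ≤ α := fun i => hW _
  have e1 : calG n hn M a ha * Matrix.diagonal W * fdiff (fine n M) ((n : ℕ) : ℂ) μ
      = calG n hn M a ha * fdiff (fine n M) ((n : ℕ) : ℂ) μ * Matrix.diagonal (shiftBack n M μ W)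
        - ((n : ℕ) : ℂ) • (calG n hn M a ha * (Matrix.diagonal W - Matrix.diagonal (shiftBack n M μ W))) := by
    rw [Matrix.mul_assoc, diagonal_mul_fdiff]
    simp only [Matrix.mul_sub, Matrix.mul_smul, Matrix.mul_assoc]
  rw [e1]
  have hd' : ‖Matrix.diagonal W - Matrix.diagonal (shiftBack n M μ W)‖ ≤ β / n := by
    rw [Matrix.diagonal_sub]; exact opNorm_diagonal_le _ (by positivity) fun i => hLip i
  have hp1 : ‖calG n hn M a ha * fdiff (fine n M) ((n : ℕ) : ℂ) μ * Matrix.diagonal (shiftBack n M μ W)‖ ≤ Cst d a * α :=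
    (Matrix.l2_opNorm_mul _ _).trans (mul_le_mul hG1 (opNorm_diagonal_le _ hα hWb) (norm_nonneg _) hC)
  have hp2 : ‖((n : ℕ) : ℂ) • (calG n hn M a ha * (Matrix.diagonal W - Matrix.diagonal (shiftBack n M μ W)))‖ ≤ Cst d a * β := by
    rw [norm_smul, Complex.norm_natCast]
    calc (n : ℝ) * ‖calG n hn M a ha * (Matrix.diagonal W - Matrix.diagonal (shiftBack n M μ W))‖ ≤ n * (Cst d a * (β / n)) :=
          mul_le_mul_of_nonneg_left ((Matrix.l2_opNorm_mul _ _).trans (mul_le_mul hG hd' (norm_nonneg _) hC)) hnpos.le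
      _ = Cst d a * β := by field_simp
  calc _ ≤ ‖calG n hn M a ha * fdiff (fine n M) ((n : ℕ) : ℂ) μ * Matrix.diagonal (shiftBack n M μ W)‖
          + ‖((n : ℕ) : ℂ) • (calG n hn M a ha * (Matrix.diagonal W - Matrix.diagonal (shiftBack n M μ W)))‖ := norm_sub_le _ _
    _ ≤ Cst d a * α + Cst d a * β := add_le_add hp1 hp2
    _ = (α + β) * Cst d a := by ring

/-- **THE DRESSED ORDER-ZERO SLOT IS BOUNDED**: `‖∇_μᴴ·(diag W₁)ᴴ·𝒢·(diag W₂)·∇_{μ′}‖ ≤ (α + β)²·Cst` for `|W_i| ≤ α` and lattice-Lipschitz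
`n·|W₁(x) − W₁(x − e_μ)| ≤ β`, `n·|W₂(x) − W₂(x − e_{μ′})| ≤ β` — the vertices adjacent to the order-zero slot cost `sup|h| + sup|∇_ηh|` (R7 S2
(B-leg)'s printed letters) and NO sup-norm rate.  Route: `∇ᴴD₁ᴴ = (D₁∇)ᴴ`, Leibniz on both sides, (1.89)'s `‖∇ᴴ𝒢∇‖`, `‖∇ᴴ𝒢‖`, `‖𝒢∇‖`, `‖𝒢‖`.
[cite: Balaban1984PropagatorsI, Prop. 1.1 (1.89) p.33, (1.31) p.23] [folklore] -/
theorem opNorm_dressedSlot_le (μ μ' : Fin d) {W₁ W₂ : Tor (fine n M) × Fin d → ℂ} {α β : ℝ} (hα : 0 ≤ α) (hβ : 0 ≤ β)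
    (hW₁ : ∀ i, ‖W₁ i‖ ≤ α) (hW₂ : ∀ i, ‖W₂ i‖ ≤ α)
    (hLip₁ : ∀ i, ‖W₁ i - shiftBack n M μ W₁ i‖ ≤ β / n) (hLip₂ : ∀ i, ‖W₂ i - shiftBack n M μ' W₂ i‖ ≤ β / n) :
    ‖(fdiff (fine n M) ((n : ℕ) : ℂ) μ)ᴴ * (Matrix.diagonal W₁)ᴴ * calG n hn M a ha * Matrix.diagonal W₂ * fdiff (fine n M) ((n : ℕ) : ℂ) μ'‖
      ≤ (α + β) * ((α + β) * Cst d a) := by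
  have hnpos : (0 : ℝ) < n := by exact_mod_cast hn
  have hC := Cst_nonneg d a
  -- the right half: `‖𝒢 D₂ ∇′‖ ≤ (α+β)Cst`
  have hR0 : ‖calG n hn M a ha * Matrix.diagonal W₂ * fdiff (fine n M) ((n : ℕ) : ℂ) μ'‖ ≤ (α + β) * Cst d a :=
    opNorm_calG_diag_fdiff_le n hn M a ha μ' hα hβ hW₂ hLip₂
  -- the left dressing through the adjoint: `∇ᴴD₁ᴴ = (D₁∇)ᴴ = D₁₋ᴴ∇ᴴ − (n(D₁ − D₁₋))ᴴ`
  have hL : (fdiff (fine n M) ((n : ℕ) : ℂ) μ)ᴴ * (Matrix.diagonal W₁)ᴴ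
      = (Matrix.diagonal (shiftBack n M μ W₁))ᴴ * (fdiff (fine n M) ((n : ℕ) : ℂ) μ)ᴴ
        - (((n : ℕ) : ℂ) • (Matrix.diagonal W₁ - Matrix.diagonal (shiftBack n M μ W₁)))ᴴ := by
    have h := congrArg Matrix.conjTranspose (diagonal_mul_fdiff n M μ W₁)
    rw [Matrix.conjTranspose_mul, Matrix.conjTranspose_sub, Matrix.conjTranspose_mul] at h
    exact h
  have hDt : ‖(Matrix.diagonal (shiftBack n M μ W₁))ᴴ‖ ≤ α := by
    rw [Matrix.l2_opNorm_conjTranspose]; exact opNorm_diagonal_le _ hα fun i => hW₁ _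
  have hEt : ‖(((n : ℕ) : ℂ) • (Matrix.diagonal W₁ - Matrix.diagonal (shiftBack n M μ W₁)))ᴴ‖ ≤ β := by
    rw [Matrix.l2_opNorm_conjTranspose, norm_smul, Complex.norm_natCast]
    have hd' : ‖Matrix.diagonal W₁ - Matrix.diagonal (shiftBack n M μ W₁)‖ ≤ β / n := by
      rw [Matrix.diagonal_sub]; exact opNorm_diagonal_le _ (by positivity) fun i => hLip₁ i
    calc (n : ℝ) * ‖Matrix.diagonal W₁ - Matrix.diagonal (shiftBack n M μ W₁)‖ ≤ n * (β / n) := mul_le_mul_of_nonneg_left hd' hnpos.le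
      _ = β := by field_simp
  -- `‖∇ᴴ (𝒢 D₂ ∇′)‖ ≤ (α+β)Cst`: `∇ᴴ𝒢D₂∇′ = ∇ᴴ𝒢∇′·D₂₋ − n·∇ᴴ𝒢·(D₂ − D₂₋)`
  have hG2 : ‖(fdiff (fine n M) ((n : ℕ) : ℂ) μ)ᴴ * (calG n hn M a ha * Matrix.diagonal W₂ * fdiff (fine n M) ((n : ℕ) : ℂ) μ')‖
      ≤ (α + β) * Cst d a := by
    have hW₂b : ∀ i, ‖shiftBack n M μ' W₂ i‖ ≤ α := fun i => hW₂ _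
    have h00 : ‖(fdiff (fine n M) ((n : ℕ) : ℂ) μ)ᴴ * calG n hn M a ha * fdiff (fine n M) ((n : ℕ) : ℂ) μ'‖ ≤ Cst d a :=
      opNorm_fdiffH_calG_fdiff_le n hn M a ha μ μ'
    have h0m : ‖(fdiff (fine n M) ((n : ℕ) : ℂ) μ)ᴴ * calG n hn M a ha‖ ≤ Cst d a := by
      have e : (fdiff (fine n M) ((n : ℕ) : ℂ) μ)ᴴ * calG n hn M a ha = (calG n hn M a ha * fdiff (fine n M) ((n : ℕ) : ℂ) μ)ᴴ := by
        rw [Matrix.conjTranspose_mul, (calG_isHermitian n hn M a ha).eq]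
      rw [e, Matrix.l2_opNorm_conjTranspose]; exact opNorm_calG_mul_fdiff_le n M a ha hn μ
    have e2 : (fdiff (fine n M) ((n : ℕ) : ℂ) μ)ᴴ * (calG n hn M a ha * Matrix.diagonal W₂ * fdiff (fine n M) ((n : ℕ) : ℂ) μ')
        = (fdiff (fine n M) ((n : ℕ) : ℂ) μ)ᴴ * calG n hn M a ha * fdiff (fine n M) ((n : ℕ) : ℂ) μ' * Matrix.diagonal (shiftBack n M μ' W₂)
          - ((n : ℕ) : ℂ) • ((fdiff (fine n M) ((n : ℕ) : ℂ) μ)ᴴ * calG n hn M a ha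
              * (Matrix.diagonal W₂ - Matrix.diagonal (shiftBack n M μ' W₂))) := by
      rw [Matrix.mul_assoc (calG n hn M a ha), diagonal_mul_fdiff]
      simp only [Matrix.mul_sub, Matrix.mul_smul, Matrix.mul_assoc]
    rw [e2]
    have hd' : ‖Matrix.diagonal W₂ - Matrix.diagonal (shiftBack n M μ' W₂)‖ ≤ β / n := by
      rw [Matrix.diagonal_sub]; exact opNorm_diagonal_le _ (by positivity) fun i => hLip₂ i
    have hp1 : ‖(fdiff (fine n M) ((n : ℕ) : ℂ) μ)ᴴ * calG n hn M a ha * fdiff (fine n M) ((n : ℕ) : ℂ) μ'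
        * Matrix.diagonal (shiftBack n M μ' W₂)‖ ≤ Cst d a * α :=
      (Matrix.l2_opNorm_mul _ _).trans (mul_le_mul h00 (opNorm_diagonal_le _ hα hW₂b) (norm_nonneg _) hC)
    have hp2 : ‖((n : ℕ) : ℂ) • ((fdiff (fine n M) ((n : ℕ) : ℂ) μ)ᴴ * calG n hn M a ha
        * (Matrix.diagonal W₂ - Matrix.diagonal (shiftBack n M μ' W₂)))‖ ≤ Cst d a * β := by
      rw [norm_smul, Complex.norm_natCast]
      calc (n : ℝ) * ‖(fdiff (fine n M) ((n : ℕ) : ℂ) μ)ᴴ * calG n hn M a ha * (Matrix.diagonal W₂ - Matrix.diagonal (shiftBack n M μ' W₂))‖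
          ≤ n * (Cst d a * (β / n)) := mul_le_mul_of_nonneg_left ((Matrix.l2_opNorm_mul _ _).trans (mul_le_mul h0m hd' (norm_nonneg _) hC)) hnpos.le
        _ = Cst d a * β := by field_simp
    calc _ ≤ _ := norm_sub_le _ _
      _ ≤ Cst d a * α + Cst d a * β := add_le_add hp1 hp2
      _ = (α + β) * Cst d a := by ring
  -- assemble: `∇ᴴD₁ᴴ·(𝒢D₂∇′) = D₁₋ᴴ·(∇ᴴ(𝒢D₂∇′)) − (n(D₁ − D₁₋))ᴴ·(𝒢D₂∇′)`
  have eassoc : (fdiff (fine n M) ((n : ℕ) : ℂ) μ)ᴴ * (Matrix.diagonal W₁)ᴴ * calG n hn M a ha * Matrix.diagonal W₂ * fdiff (fine n M) ((n : ℕ) : ℂ) μ'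
      = (Matrix.diagonal (shiftBack n M μ W₁))ᴴ
          * ((fdiff (fine n M) ((n : ℕ) : ℂ) μ)ᴴ * (calG n hn M a ha * Matrix.diagonal W₂ * fdiff (fine n M) ((n : ℕ) : ℂ) μ'))
        - (((n : ℕ) : ℂ) • (Matrix.diagonal W₁ - Matrix.diagonal (shiftBack n M μ W₁)))ᴴ
          * (calG n hn M a ha * Matrix.diagonal W₂ * fdiff (fine n M) ((n : ℕ) : ℂ) μ') := by
    rw [hL]
    simp only [Matrix.sub_mul, Matrix.mul_assoc]
  rw [eassoc]
  calc _ ≤ ‖(Matrix.diagonal (shiftBack n M μ W₁))ᴴ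
            * ((fdiff (fine n M) ((n : ℕ) : ℂ) μ)ᴴ * (calG n hn M a ha * Matrix.diagonal W₂ * fdiff (fine n M) ((n : ℕ) : ℂ) μ'))‖
          + ‖(((n : ℕ) : ℂ) • (Matrix.diagonal W₁ - Matrix.diagonal (shiftBack n M μ W₁)))ᴴ
            * (calG n hn M a ha * Matrix.diagonal W₂ * fdiff (fine n M) ((n : ℕ) : ℂ) μ')‖ := norm_sub_le _ _
    _ ≤ α * ((α + β) * Cst d a) + β * ((α + β) * Cst d a) :=
        add_le_add ((Matrix.l2_opNorm_mul _ _).trans (mul_le_mul hDt hG2 (norm_nonneg _) hα))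
          ((Matrix.l2_opNorm_mul _ _).trans (mul_le_mul hEt hR0 (norm_nonneg _) hβ))
    _ = (α + β) * ((α + β) * Cst d a) := by ring

end Level

end Summit.QuantumFields.BalabanUV.Beta.GAN24.DressedOrderZeroSlotLaw

end
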